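import Summits.CriticalPhenomena.PercolationContinuityZ3.Theorems.SahiMasterFamilyExPoly
import Mathlib.Combinatorics.Nullstellensatz

/-!
# (T) for triples with non-vanishing top Möbius coefficients: the top monomial of `E_3`

Companion of `SahiMasterFamilyHeredity.lean` / `SahiMasterFamilyCommonPivotal.lean` (crux `NoHeavyLowerTail`,
stmt-CriticalPhenomena-4575; unit `prim-master-conj`).  The identically-zero form of the master equality conjecture
at order 3 was reduced there to (T) `SahiE3NonvanishingOfPairwiseDependent`.  This file proves a large case of (T)
by a NEW, purely algebraic argument (no minors, no structure theorem), using the polynomial expectations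
`exPoly` and Möbius coefficients `mobCoeff` of `SahiMasterFamilyExPoly.lean`:

* `sahiE3Poly f g h` — Sahi's `E_3` as a polynomial in the parameters (`eval_sahiE3Poly`), of degree `≤ 3` in
  each variable;
* **the top-monomial identity** (`coeff_top_sahiE3Poly`): if `f, g, h` are determined by `S_0, S_1, S_2` and the
  three sets PAIRWISE INTERSECT, then the coefficient of `X^{S_0} X^{S_1} X^{S_2}` in `E_3` is
  `ĉ_{S_0}(f) ĉ_{S_1}(g) ĉ_{S_2}(h)`: every other term of `E_3 = 2E(fgh) + E(f)E(g)E(h) − Σ E(f)E(gh)` contains a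
  multilinear factor `E(gh)` whose degree in a shared variable `e ∈ S_1 ∩ S_2` is `≤ 1 < 2`;
* hence (Alon's Nullstellensatz on the grid `{1/5,…,4/5}^ι`) **`E_3(μ_p; f, g, h) ≠ 0` for some interior `p`
  whenever the three top Möbius coefficients are non-zero** (`sahiE_three_ne_zero_of_mobCoeff`); in particular
  (T) holds for every pairwise-dependent triple of events whose top Möbius coefficients (`= ±` the reduced Euler
  characteristics of the complementary simplicial complexes) do not vanish (`sahiE3Nonvanishing_of_mobCoeff`).
This covers the triangle `x∨y, x∨z, y∨z` and all "bowties" `AND(P)·OR(Q)` (top coefficient `±1`); what remains of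
(T) are triples containing an event with vanishing top coefficient (e.g. `ab ∨ bc ∨ cd`).  No monotonicity is used.
Everything here is proved; axioms standard. [this work]
-/

noncomputable section

open scoped Classical

namespace Summit.CriticalPhenomena.PercolationContinuityZ3.Theorems

open Finset Function MvPolynomial
open Literature.Computability.AlgebraicComplexity (blockProfile blockProfile_apply blockProfile_injective)
open Literature.Combinatorics.Sahi2008
open Literature.Probability.Percolation (DeterminedBy determinedBy_iff)
open Literature.Probability.Percolation.BHK2006 (weight)
open Literature.Probability.Percolation.DecisionTree (ind ind_of_mem ind_of_not_mem ind_nonneg)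

section Poly

variable {ι : Type*} [Fintype ι]

/-! ### `E_3` as a polynomial and its top monomial -/

/-- **Sahi's `E_3` as a polynomial in the parameters**:
`2E(fgh) + E(f)E(g)E(h) − (E(f)E(gh) + E(g)E(fh) + E(h)E(fg))` with `E = exPoly`. [this work] -/
def sahiE3Poly (f g h : Set ι → ℝ) : MvPolynomial ι ℝ :=
  C 2 * exPoly (f * g * h) + exPoly f * exPoly g * exPoly h -
    (exPoly f * exPoly (g * h) + exPoly g * exPoly (f * h) + exPoly h * exPoly (f * g))

/-- `sahiE3Poly` evaluates to `E_3` under the product weight. [this work] -/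
theorem eval_sahiE3Poly (x : ι → ℝ) (f g h : Set ι → ℝ) :
    eval x (sahiE3Poly f g h) = sahiE (weight x) 3 ![f, g, h] := by
  rw [sahiE_three]
  simp only [sahiE3Poly, map_add, map_sub, map_mul, eval_C, eval_exPoly]

/-- `E_3` has degree `≤ 3` in every variable. [this work] -/
theorem degreeOf_sahiE3Poly_le (f g h : Set ι → ℝ) (e : ι) : degreeOf e (sahiE3Poly f g h) ≤ 3 := by
  have h1 : ∀ k : Set ι → ℝ, degreeOf e (exPoly k) ≤ 1 := fun k => degreeOf_exPoly_le k e
  have hC : degreeOf e (C 2 * exPoly (f * g * h)) ≤ 1 := (degreeOf_C_mul_le _ _ _).trans (h1 _)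
  have hfgh : degreeOf e (exPoly f * exPoly g * exPoly h) ≤ 3 :=
    (degreeOf_mul_le _ _ _).trans (by
      have := (degreeOf_mul_le e (exPoly f) (exPoly g)).trans (add_le_add (h1 f) (h1 g))
      have := h1 h; omega)
  have hpair : ∀ k l : Set ι → ℝ, degreeOf e (exPoly k * exPoly l) ≤ 2 := fun k l =>
    (degreeOf_mul_le _ _ _).trans (add_le_add (h1 k) (h1 l))
  unfold sahiE3Poly
  refine (degreeOf_sub_le _ _ _).trans (max_le ?_ ?_)
  · exact (degreeOf_add_le _ _ _).trans (max_le (hC.trans (by norm_num)) hfgh)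
  · refine (degreeOf_add_le _ _ _).trans (max_le ?_ ((hpair h _).trans (by norm_num)))
    exact (degreeOf_add_le _ _ _).trans (max_le ((hpair f _).trans (by norm_num)) ((hpair g _).trans (by norm_num)))

/-- **The top-monomial identity.** If `f, g, h` are determined by `S_0, S_1, S_2` and the three sets pairwise
intersect, the coefficient of `X^{S_0}·X^{S_1}·X^{S_2}` in `E_3(f,g,h)` is `ĉ_{S_0}(f)·ĉ_{S_1}(g)·ĉ_{S_2}(h)`:
only `E(f)E(g)E(h)` reaches this monomial, every other term of `E_3` having a multilinear factor `E(gh)`,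
`E(fh)`, `E(fg)` or `E(fgh)` of degree `≤ 1 < 2` in a shared variable. [this work] -/
theorem coeff_top_sahiE3Poly (f g h : Set ι → ℝ) (S₀ S₁ S₂ : Finset ι)
    (hf : ∀ ω ω' : Set ι, ω ∩ ↑S₀ = ω' ∩ ↑S₀ → f ω = f ω')
    (hg : ∀ ω ω' : Set ι, ω ∩ ↑S₁ = ω' ∩ ↑S₁ → g ω = g ω')
    (hh : ∀ ω ω' : Set ι, ω ∩ ↑S₂ = ω' ∩ ↑S₂ → h ω = h ω')
    (h01 : (S₀ ∩ S₁).Nonempty) (h02 : (S₀ ∩ S₂).Nonempty) (h12 : (S₁ ∩ S₂).Nonempty) :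
    coeff (blockProfile S₀ + blockProfile S₁ + blockProfile S₂) (sahiE3Poly f g h) =
      mobCoeff f S₀ * mobCoeff g S₁ * mobCoeff h S₂ := by
  -- support bounds
  have sf := fun m hm => le_blockProfile_of_mem_support_exPoly hf (m := m) hm
  have sg := fun m hm => le_blockProfile_of_mem_support_exPoly hg (m := m) hm
  have sh := fun m hm => le_blockProfile_of_mem_support_exPoly hh (m := m) hm
  have su : ∀ k : Set ι → ℝ, ∀ m ∈ (exPoly k).support, m ≤ blockProfile univ :=
    fun k m hm => le_blockProfile_univ_of_mem_support_exPoly hm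
  -- a shared variable is where the target exceeds the competitor's bound
  have key : ∀ {A B : Finset ι} (a : ι →₀ ℕ), (A ∩ B).Nonempty → (∀ e, a e ≤ 1) →
      ¬ (a + blockProfile A + blockProfile B ≤ a + blockProfile univ) := by
    intro A B a hAB ha hle
    obtain ⟨e, he⟩ := hAB
    have h1 := hle e
    simp only [Finsupp.coe_add, Pi.add_apply, blockProfile_apply, mem_univ, if_true,
      if_pos (mem_inter.1 he).1, if_pos (mem_inter.1 he).2] at h1
    omega
  have hb0 : ∀ e, blockProfile S₀ e ≤ 1 := fun e => by rw [blockProfile_apply]; split_ifs <;> simp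
  have hb1 : ∀ e, blockProfile S₁ e ≤ 1 := fun e => by rw [blockProfile_apply]; split_ifs <;> simp
  have hb2 : ∀ e, blockProfile S₂ e ≤ 1 := fun e => by rw [blockProfile_apply]; split_ifs <;> simp
  -- the main term
  have hmain : coeff (blockProfile S₀ + blockProfile S₁ + blockProfile S₂) (exPoly f * exPoly g * exPoly h) =
      mobCoeff f S₀ * mobCoeff g S₁ * mobCoeff h S₂ := by
    rw [coeff_add_mul_of_support_le (support_mul_le sf sg) sh, coeff_add_mul_of_support_le sf sg,
      coeff_blockProfile_exPoly, coeff_blockProfile_exPoly, coeff_blockProfile_exPoly]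
  -- the three pair terms vanish
  have hp0 : coeff (blockProfile S₀ + blockProfile S₁ + blockProfile S₂) (exPoly f * exPoly (g * h)) = 0 :=
    coeff_mul_eq_zero_of_not_le sf (su _) (by
      have := key (blockProfile S₀) h12 hb0
      rwa [add_assoc] at this ⊢ )
  have hp1 : coeff (blockProfile S₀ + blockProfile S₁ + blockProfile S₂) (exPoly g * exPoly (f * h)) = 0 :=
    coeff_mul_eq_zero_of_not_le sg (su _) (by
      have := key (blockProfile S₁) h02 hb1
      intro hle; apply this
      intro e; have := hle e
      simp only [Finsupp.coe_add, Pi.add_apply] at this ⊢; omega)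
  have hp2 : coeff (blockProfile S₀ + blockProfile S₁ + blockProfile S₂) (exPoly h * exPoly (f * g)) = 0 :=
    coeff_mul_eq_zero_of_not_le sh (su _) (by
      have := key (blockProfile S₂) h01 hb2
      intro hle; apply this
      intro e; have := hle e
      simp only [Finsupp.coe_add, Pi.add_apply] at this ⊢; omega)
  -- the triple-intersection term vanishes
  have ht : coeff (blockProfile S₀ + blockProfile S₁ + blockProfile S₂) (C 2 * exPoly (f * g * h)) = 0 := by
    rw [coeff_C_mul, coeff_eq_zero_of_not_le (su _) ?_, mul_zero]
    intro hle
    obtain ⟨e, he⟩ := h12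
    have h1 := hle e
    simp only [Finsupp.coe_add, Pi.add_apply, blockProfile_apply, mem_univ, if_true,
      if_pos (mem_inter.1 he).1, if_pos (mem_inter.1 he).2] at h1
    omega
  simp only [sahiE3Poly, coeff_add, coeff_sub, hmain, hp0, hp1, hp2, ht]
  ring

/-! ### Non-vanishing via the Combinatorial Nullstellensatz -/

/-- The four interior grid values `k/5`, `k = 1,…,4`. [folklore] -/
def gridFifths : Finset ℝ := {1 / 5, 2 / 5, 3 / 5, 4 / 5}

omit [Fintype ι] in
/-- The grid has four points. [folklore] -/
theorem card_gridFifths : gridFifths.card = 4 := by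
  simp only [gridFifths]
  rw [card_insert_of_notMem (by norm_num), card_insert_of_notMem (by norm_num),
    card_insert_of_notMem (by norm_num), card_singleton]

omit [Fintype ι] in
/-- Grid points are interior. [folklore] -/
theorem mem_Ioo_of_mem_gridFifths {t : ℝ} (ht : t ∈ gridFifths) : t ∈ Set.Ioo (0 : ℝ) 1 := by
  simp only [gridFifths, mem_insert, mem_singleton] at ht
  rcases ht with rfl | rfl | rfl | rfl <;> constructor <;> norm_num

/-- **`E_3 ≠ 0` somewhere in the open cube when the three top Möbius coefficients are non-zero.**  For real
functions `f, g, h` on configurations determined by pairwise-intersecting coordinate sets `S_0, S_1, S_2` with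
`ĉ_{S_0}(f) ĉ_{S_1}(g) ĉ_{S_2}(h) ≠ 0`, some parameter vector `p ∈ {1/5,…,4/5}^ι` has `E_3(μ_p; f, g, h) ≠ 0`
(top-monomial identity + Alon's Nullstellensatz, `E_3` having degree `≤ 3 < 4` in each variable). [this work] -/
theorem sahiE_three_ne_zero_of_mobCoeff (f g h : Set ι → ℝ) (S₀ S₁ S₂ : Finset ι)
    (hf : ∀ ω ω' : Set ι, ω ∩ ↑S₀ = ω' ∩ ↑S₀ → f ω = f ω')
    (hg : ∀ ω ω' : Set ι, ω ∩ ↑S₁ = ω' ∩ ↑S₁ → g ω = g ω')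
    (hh : ∀ ω ω' : Set ι, ω ∩ ↑S₂ = ω' ∩ ↑S₂ → h ω = h ω')
    (h01 : (S₀ ∩ S₁).Nonempty) (h02 : (S₀ ∩ S₂).Nonempty) (h12 : (S₁ ∩ S₂).Nonempty)
    (hc : mobCoeff f S₀ * mobCoeff g S₁ * mobCoeff h S₂ ≠ 0) :
    ∃ p : ι → unitInterval, (∀ e, (p e : ℝ) ∈ Set.Ioo (0 : ℝ) 1) ∧
      sahiE (bernoulliWeight p) 3 ![f, g, h] ≠ 0 := by
  have hne : sahiE3Poly f g h ≠ 0 := by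
    intro h0
    have := coeff_top_sahiE3Poly f g h S₀ S₁ S₂ hf hg hh h01 h02 h12
    rw [h0, coeff_zero] at this
    exact hc this.symm
  have hex : ∃ x : ι → ℝ, (∀ e, x e ∈ gridFifths) ∧ eval x (sahiE3Poly f g h) ≠ 0 := by
    by_contra hall
    push Not at hall
    exact hne (eq_zero_of_eval_zero_at_prod_finset _ (fun _ => gridFifths)
      (fun e => (degreeOf_sahiE3Poly_le f g h e).trans_lt (by rw [card_gridFifths]; norm_num)) hall)
  obtain ⟨x, hx, hxne⟩ := hex
  have hx01 : ∀ e, x e ∈ Set.Ioo (0 : ℝ) 1 := fun e => mem_Ioo_of_mem_gridFifths (hx e)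
  refine ⟨fun e => ⟨x e, (hx01 e).1.le, (hx01 e).2.le⟩, hx01, ?_⟩
  rw [eval_sahiE3Poly] at hxne
  exact hxne

end Poly

/-- **(T) for triples with non-vanishing top Möbius coefficients.**  Three events on a finite `ι`, determined by
pairwise-intersecting coordinate sets `S_j` on which their top Möbius coefficients `ĉ_{S_j}(1_{U_j})` are non-zero,
have `E_3(μ_p; 1_{U_0}, 1_{U_1}, 1_{U_2}) ≠ 0` for some interior `p` — the conclusion of
`SahiE3NonvanishingOfPairwiseDependent` for them (non-vanishing of `ĉ_{S_j}` forces `S_j` to be the essential support,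
so such triples are exactly the pairwise-dependent triples whose three reduced Euler characteristics are non-zero; no
monotonicity is needed). [this work] -/
theorem sahiE3Nonvanishing_of_mobCoeff {ι : Type} [Fintype ι] (U : Fin 3 → Set (Set ι)) (S : Fin 3 → Finset ι)
    (hS : ∀ j, DeterminedBy (U j) (↑(S j) : Set ι))
    (h01 : (S 0 ∩ S 1).Nonempty) (h02 : (S 0 ∩ S 2).Nonempty) (h12 : (S 1 ∩ S 2).Nonempty)
    (hc : ∀ j, mobCoeff (ind (U j)) (S j) ≠ 0) :
    ∃ p : ι → unitInterval, (∀ e, (p e : ℝ) ∈ Set.Ioo (0 : ℝ) 1) ∧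
      sahiE (bernoulliWeight p) 3 (fun j => ind (U j)) ≠ 0 := by
  have hF : (fun j => ind (U j)) = ![ind (U 0), ind (U 1), ind (U 2)] := by
    funext j; fin_cases j <;> rfl
  rw [hF]
  exact sahiE_three_ne_zero_of_mobCoeff _ _ _ (S 0) (S 1) (S 2) (ind_determinedBy (hS 0))
    (ind_determinedBy (hS 1)) (ind_determinedBy (hS 2)) h01 h02 h12
    (mul_ne_zero (mul_ne_zero (hc 0) (hc 1)) (hc 2))

end Summit.CriticalPhenomena.PercolationContinuityZ3.Theorems
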